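import Mathlib.NumberTheory.Padics.PadicIntegers
import Mathlib.Topology.Homeomorph.Lemmas
import Literature.AnabelianGeometry.Anabelioids.ProSigmaProofs
import Literature.AnabelianGeometry.AbsoluteAnabelian.FreeProcyclicStructure
import Literature.AnabelianGeometry.AbsoluteAnabelian.FreeProcyclicModel
import HarnessLib

/-!
# Subgroups of `Ẑ^Σ` are `Ẑ^{Σ'}`: open and closed subgroups of free pro-`Σ`-cyclic groups

[AbsTopII] (S. Mochizuki, *Topics in Absolute Anabelian Geometry II*, J. Math. Sci. Univ. Tokyo 20
(2013)) Prop. 1.3 (i) p. 11 types the edge-like subgroups of a pro-`Σ` PSC fundamental group as "as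
abstract profinite groups, `≅ Ẑ^Σ`"; abc-iut-L4-t6 rendered this intrinsically as
`AbsTopII.IsFreeProSigmaCyclic Σ G` (a dense cyclic subgroup; the indices of open subgroups are exactly
the `Σ`-integers), with the structure theorem `IsFreeProSigmaCyclic.exists_continuousMulEquiv_padicSigmaProd`
(`G ≃ₜ* ∏_{p ∈ Σ} ℤ_p` on compact Hausdorff totally disconnected carriers) and the model
`isFreeProSigmaCyclic_padicProdOn` (abc-iut-w5-d024).  Print passes silently between an inertia group
and its intersection with an open subgroup ([CombGC] Rmk 1.1.3; [AbsTopI] Lemma 4.5 (iv) "`I·J`",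
"`I^l·J`"; the restriction of PSC data to an open subgroup `V`, whose cuspidal subgroups are
`V ∩ γΠ_cγ⁻¹`).  This proof-only file (no definitions) supplies the classical facts that make such
passages available for the intrinsic predicate:

* `isFreeProSigmaCyclic_padicPi` — for ANY injective family of primes `P : ι → ℕ`, the product
  `∏_i ℤ_{P i}` is free pro-`(range P)`-cyclic (the model over an arbitrary index type);
* `AbsTopII.IsFreeProSigmaCyclic.subgroup_of_isOpen` — **open subgroups of `Ẑ^Σ` are `≅ Ẑ^Σ`**: in a
  compact Hausdorff free pro-`Σ`-cyclic group every open subgroup is free pro-`Σ`-cyclic (no structure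
  theorem needed: the open subgroup of index `n` is `closure ⟨gⁿ⟩`);
* `AddSubgroup`s of `∏_i ℤ_{P i}` that are CLOSED are products of closed ideals `p_i^{e_i} ℤ_{p_i}` /
  `0` (`mem_iff_forall_single_mem_of_isClosed`, `exists_pow_span_eq_of_isClosed`), whence
* `exists_subset_range_isFreeProSigmaCyclic_of_isClosed_padicPi` — **closed subgroups of
  `∏_i ℤ_{p_i}` are `≅ ∏_{i ∈ ι'} ℤ_{p_i}`**, i.e. free pro-`Σ'`-cyclic for some `Σ' ⊆ range P`; the
  transport to an ABSTRACT free pro-`Σ`-cyclic profinite group (`exists_subset_of_isClosed`, the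
  `Σ = {l}` dichotomy "`⊥` or `≅ ℤ_l`") is the sequel `FreeProSigmaCyclicClosedSubgroups`.

Classical profinite group theory [cite: RibesZalesskii2010, Thm 2.7.1]; HONEST FRAMING: nothing here
bears on [IUTchIII] Cor. 3.12; typed ≠ proved elsewhere; no side is taken on any disputed claim.
-/

noncomputable section

open Topology
open scoped Pointwise

namespace Literature.AnabelianGeometry.AbsoluteAnabelian

open Literature.AnabelianGeometry.Anabelioids (IsSigmaInteger)

universe u

/-! ### The model over an arbitrary injective family of primes -/

section PadicPiModel

variable {ι : Type u} (P : ι → ℕ) [hP : ∀ i, Fact (Nat.Prime (P i))]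

/-- **`∏_i ℤ_{p_i}` is free pro-`{p_i}`-cyclic** for every injective family of primes `P : ι → ℕ`:
`1` is a topological generator (CRT), there is an open subgroup of every `(range P)`-integer index,
and no open subgroup has index divisible by a prime outside the family.
[cite: MochizukiAbsTopII2013, Prop 1.3 (i) p.11] -/
theorem isFreeProSigmaCyclic_padicPi (hinj : Function.Injective P) :
    AbsTopII.IsFreeProSigmaCyclic (Set.range P) (Multiplicative (∀ i, ℤ_[P i])) := by
  refine @AbsTopII.IsFreeProSigmaCyclic.mk _ _ _ _ ?_ ?_
  · exact ⟨_, dense_zpowers_ofAdd_one_padicPi P hinj⟩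
  · intro n
    constructor
    · rintro ⟨K, hKo, hKi⟩
      haveI : Finite (Multiplicative (∀ i, ℤ_[P i]) ⧸ K) := Subgroup.quotient_finite_of_isOpen K hKo
      haveI : K.FiniteIndex := Subgroup.finiteIndex_of_finite_quotient
      refine ⟨hKi ▸ Nat.pos_of_ne_zero Subgroup.FiniteIndex.index_ne_zero, fun q hq hqn => ?_⟩
      by_contra hqS
      have hne : ∀ i, P i ≠ q := fun i h => hqS ⟨i, h⟩
      exact not_dvd_index_of_isOpen_padicPi P hq hne K hKo (hKi ▸ hqn)
    · rintro ⟨hn, hS⟩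
      refine exists_isOpen_subgroup_index_padicPi P hn.ne' fun q hq => ?_
      obtain ⟨i, hi⟩ := hS q (Nat.prime_of_mem_primeFactors hq) (Nat.dvd_of_mem_primeFactors hq)
      exact ⟨i, hi⟩

end PadicPiModel

/-! ### Open subgroups of `Ẑ^Σ` -/

section OpenSubgroups

variable {G : Type u} [Group G] [TopologicalSpace G] [IsTopologicalGroup G]

/-- **Open subgroups of `Ẑ^Σ` are `≅ Ẑ^Σ`.**  In a compact Hausdorff group `G` with a dense cyclic
subgroup `⟨g⟩` whose open subgroups have exactly the `Σ`-integers as indices, an open subgroup `U`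
(of index `n`, a `Σ`-integer) is `closure ⟨gⁿ⟩`, topologically generated by `gⁿ`; an open subgroup
of `U` is an open subgroup of `G`, so its index in `U` divides a `Σ`-integer; and for a `Σ`-integer
`m` the open subgroup `closure ⟨g^{nm}⟩ ⊆ U` of `G` has index `m` in `U`.
[cite: MochizukiAbsTopII2013, Prop 1.3 (i) p.11] -/
theorem AbsTopII.IsFreeProSigmaCyclic.subgroup_of_isOpen {S : Set ℕ} [T2Space G] [CompactSpace G]
    (h : AbsTopII.IsFreeProSigmaCyclic S G) (U : Subgroup G) (hU : IsOpen (U : Set G)) :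
    AbsTopII.IsFreeProSigmaCyclic S U := by
  classical
  obtain ⟨g, hg⟩ := h.exists_dense_zpowers
  haveI : Finite (G ⧸ U) := Subgroup.quotient_finite_of_isOpen U hU
  haveI : U.FiniteIndex := Subgroup.finiteIndex_of_finite_quotient
  obtain ⟨n, hn⟩ : ∃ n : ℕ, U.index = n := ⟨_, rfl⟩
  have hnS : IsSigmaInteger S n := (h.isOpen_index_iff n).mp ⟨U, hU, hn⟩
  have hn0 : 0 < n := hnS.1
  have hUeq : U = (Subgroup.zpowers (g ^ n)).topologicalClosure :=
    eq_closureZpowersPow_of_isOpen_of_index hg hU hn0 hn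
  have hgnU : g ^ n ∈ U := by
    have h1 := Subgroup.le_topologicalClosure (Subgroup.zpowers (g ^ n)) (Subgroup.mem_zpowers _)
    rwa [← hUeq] at h1
  refine ⟨⟨⟨g ^ n, hgnU⟩, ?_⟩, fun m => ⟨?_, fun hm => ?_⟩⟩
  · -- `⟨gⁿ⟩` is dense in `U = closure ⟨gⁿ⟩`
    have himg : Subtype.val '' ((Subgroup.zpowers (⟨g ^ n, hgnU⟩ : U) : Subgroup U) : Set U) =
        ((Subgroup.zpowers (g ^ n) : Subgroup G) : Set G) := by
      rw [← Subgroup.coe_subtype, ← Subgroup.coe_map, MonoidHom.map_zpowers]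
      rfl
    rw [dense_iff_closure_eq, Set.eq_univ_iff_forall]
    intro x
    rw [closure_subtype, himg, ← Subgroup.topologicalClosure_coe, ← hUeq]
    exact x.2
  · -- an open subgroup `W` of `U` is open in `G` with `[G : W] = [U : W] · n` a `Σ`-integer
    rintro ⟨W, hWo, rfl⟩
    have hWG : IsOpen ((W.map U.subtype : Subgroup G) : Set G) := by
      rw [Subgroup.coe_map]
      exact hU.isOpenMap_subtype_val _ hWo
    have hidx : (W.map U.subtype).index = W.index * U.index := Subgroup.index_map_subtype W
    have hSG : IsSigmaInteger S (W.map U.subtype).index :=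
      (h.isOpen_index_iff _).mp ⟨_, hWG, rfl⟩
    exact hSG.of_dvd ⟨U.index, hidx⟩
  · -- the open subgroup of index `n * m` of `G` lies in `U` with index `m`
    have hnm : IsSigmaInteger S (n * m) := hnS.mul hm
    obtain ⟨hWo, hWi⟩ :=
      isOpen_closureZpowersPow hg hnm.1 ((h.isOpen_index_iff (n * m)).mpr hnm)
    set W := (Subgroup.zpowers (g ^ (n * m))).topologicalClosure with hW
    have hWU : W ≤ U := by
      rw [hUeq]
      refine Subgroup.topologicalClosure_minimal _ ?_ (Subgroup.isClosed_topologicalClosure _)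
      rw [Subgroup.zpowers_le, pow_mul]
      exact Subgroup.le_topologicalClosure _ (Subgroup.pow_mem _ (Subgroup.mem_zpowers _) m)
    refine ⟨W.subgroupOf U, ?_, ?_⟩
    · change IsOpen (U.subtype ⁻¹' (W : Set G))
      exact hWo.preimage continuous_subtype_val
    · have h1 := Subgroup.relIndex_mul_index hWU
      rw [hWi, hn] at h1
      have h2 : W.relIndex U * n = m * n := by rw [h1, mul_comm]
      exact Nat.eq_of_mul_eq_mul_right hn0 h2

/-- The `IsFreeProcyclic` form (`Σ` = all primes) is abc-iut-L4's
`FundamentalExtension.IsFreeProcyclic.subgroup_of_isOpen` (AbsTopIThm26iProofs); recorded here is the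
closed-subgroup variant of the OPEN case: a closed subgroup of finite index of a compact Hausdorff free
pro-`Σ`-cyclic group is free pro-`Σ`-cyclic (finite index + closed ⇒ open).
[cite: MochizukiAbsTopII2013, Prop 1.3 (i) p.11] -/
theorem AbsTopII.IsFreeProSigmaCyclic.subgroup_of_isClosed_of_finiteIndex {S : Set ℕ} [T2Space G]
    [CompactSpace G] (h : AbsTopII.IsFreeProSigmaCyclic S G) (U : Subgroup G)
    (hU : IsClosed (U : Set G)) [U.FiniteIndex] : AbsTopII.IsFreeProSigmaCyclic S U :=
  h.subgroup_of_isOpen U (Subgroup.isOpen_of_isClosed_of_finiteIndex U hU)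

end OpenSubgroups

/-! ### Closed subgroups of `∏_i ℤ_{p_i}`: closed subgroups are products of closed ideals -/

section ClosedSubgroupsModel

variable {ι : Type u} (P : ι → ℕ) [hP : ∀ i, Fact (Nat.Prime (P i))]

/-- A closed additive subgroup `H` of the compact ring `∏_i ℤ_{p_i}` (injective family of primes) is an
IDEAL: `{r | r·x ∈ H}` is closed and contains the dense image of `ℕ`.
[cite: RibesZalesskii2010, Thm 2.7.1] -/
theorem mul_mem_of_isClosed_padicPi (hinj : Function.Injective P) (H : AddSubgroup (∀ i, ℤ_[P i]))
    (hH : IsClosed (H : Set (∀ i, ℤ_[P i]))) (r : ∀ i, ℤ_[P i]) {x : ∀ i, ℤ_[P i]} (hx : x ∈ H) :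
    r * x ∈ H := by
  have hcl : IsClosed {s : ∀ i, ℤ_[P i] | s * x ∈ H} :=
    hH.preimage (continuous_id.mul continuous_const)
  have hsub : Set.range (fun m : ℕ => (fun i : ι => ((m : ℕ) : ℤ_[P i]))) ⊆
      {s : ∀ i, ℤ_[P i] | s * x ∈ H} := by
    rintro _ ⟨m, rfl⟩
    have h1 : (fun i : ι => ((m : ℕ) : ℤ_[P i])) * x = m • x := by
      funext i; simp only [Pi.mul_apply, Pi.smul_apply, nsmul_eq_mul]
    change (fun i : ι => ((m : ℕ) : ℤ_[P i])) * x ∈ H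
    rw [h1]
    exact H.nsmul_mem hx m
  have hd : Dense {s : ∀ i, ℤ_[P i] | s * x ∈ H} := (dense_range_natCast_padicPi P hinj).mono hsub
  have huniv : {s : ∀ i, ℤ_[P i] | s * x ∈ H} = Set.univ := by
    rw [← hcl.closure_eq]; exact hd.closure_eq
  have hr : r ∈ {s : ∀ i, ℤ_[P i] | s * x ∈ H} := by rw [huniv]; exact Set.mem_univ r
  exact hr

/-- Each coordinate of a member of a closed subgroup `H ⊆ ∏_i ℤ_{p_i}`, placed alone, is a member
(multiply by the idempotent `e_i`). [cite: RibesZalesskii2010, Thm 2.7.1] -/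
theorem single_apply_mem_of_isClosed_padicPi [DecidableEq ι] (hinj : Function.Injective P)
    (H : AddSubgroup (∀ i, ℤ_[P i])) (hH : IsClosed (H : Set (∀ i, ℤ_[P i]))) {x : ∀ i, ℤ_[P i]}
    (hx : x ∈ H) (i : ι) : Pi.single i (x i) ∈ H := by
  have h1 : Pi.single i (x i) = Pi.single i (1 : ℤ_[P i]) * x := by
    rw [← Pi.single_mul_left, one_mul]
  rw [h1]
  exact mul_mem_of_isClosed_padicPi P hinj H hH _ hx

/-- **Membership in a closed subgroup of `∏_i ℤ_{p_i}` is coordinatewise**: `x ∈ H` iff every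
`e_i · x ∈ H` (the finite partial sums of the `e_i · x` lie in `H` and converge to `x`; `H` is
closed). [cite: RibesZalesskii2010, Thm 2.7.1] -/
theorem mem_iff_forall_single_mem_of_isClosed_padicPi [DecidableEq ι] (hinj : Function.Injective P)
    (H : AddSubgroup (∀ i, ℤ_[P i])) (hH : IsClosed (H : Set (∀ i, ℤ_[P i]))) (x : ∀ i, ℤ_[P i]) :
    x ∈ H ↔ ∀ i, Pi.single i (x i) ∈ H := by
  refine ⟨fun hx i => single_apply_mem_of_isClosed_padicPi P hinj H hH hx i, fun hx => ?_⟩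
  have hcl : x ∈ closure (H : Set (∀ i, ℤ_[P i])) := by
    rw [mem_closure_iff]
    intro U hU hxU
    obtain ⟨I, w, hw, hIU⟩ := isOpen_pi_iff.mp hU x hxU
    refine ⟨∑ i ∈ I, Pi.single i (x i), hIU ?_, H.sum_mem fun i _ => hx i⟩
    intro j hj
    rw [Finset.sum_apply, Finset.sum_pi_single, if_pos (Finset.mem_coe.mp hj)]
    exact (hw j (Finset.mem_coe.mp hj)).2
  rwa [hH.closure_eq] at hcl

/-- **The `i`-th slice of a closed subgroup `H ⊆ ∏_i ℤ_{p_i}` is `0` or `p_i^{e} ℤ_{p_i}`**: the slice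
`{y | e_i·y ∈ H}` is an ideal of the discrete valuation ring `ℤ_{p_i}` (Mathlib
`PadicInt.ideal_eq_span_pow_p`). [cite: RibesZalesskii2010, Thm 2.7.1] -/
theorem slice_eq_bot_or_pow_of_isClosed_padicPi [DecidableEq ι] (hinj : Function.Injective P)
    (H : AddSubgroup (∀ i, ℤ_[P i])) (hH : IsClosed (H : Set (∀ i, ℤ_[P i]))) (i : ι) :
    (∀ x ∈ H, x i = 0) ∨
      ∃ e : ℕ, ∀ y : ℤ_[P i], Pi.single i y ∈ H ↔ (P i : ℤ_[P i]) ^ e ∣ y := by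
  let J : Ideal ℤ_[P i] :=
    { carrier := {y | Pi.single i y ∈ H}
      add_mem' := fun {a b} ha hb => by
        change Pi.single i (a + b) ∈ H
        rw [Pi.single_add]
        exact H.add_mem ha hb
      zero_mem' := by
        change Pi.single i (0 : ℤ_[P i]) ∈ H
        rw [Pi.single_zero]
        exact H.zero_mem
      smul_mem' := fun c {y} hy => by
        change Pi.single i (c * y) ∈ H
        rw [Pi.single_mul]
        exact mul_mem_of_isClosed_padicPi P hinj H hH _ hy }
  by_cases hJ : J = ⊥
  · left
    intro x hx
    have h1 : x i ∈ J := single_apply_mem_of_isClosed_padicPi P hinj H hH hx i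
    rw [hJ, Ideal.mem_bot] at h1
    exact h1
  · right
    obtain ⟨e, he⟩ := PadicInt.ideal_eq_span_pow_p hJ
    refine ⟨e, fun y => ?_⟩
    change y ∈ J ↔ _
    rw [he, Ideal.mem_span_singleton]

/-- **Closed subgroups of `∏_i ℤ_{p_i}` are `≅ ∏_{i ∈ ι'} ℤ_{p_i}`**: a closed subgroup `H` of
`∏_i ℤ_{p_i}` (written multiplicatively) is free pro-`Σ'`-cyclic for `Σ' =` the primes `p_i` whose
slice is nonzero — the map `(y_j)_{j ∈ ι'} ↦ (p_j^{e_j} y_j)_j` (extended by `0`) is a continuous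
additive bijection from the compact group `∏_{ι'} ℤ_{p_j}` onto the Hausdorff group `H`, hence an
isomorphism of topological groups. [cite: RibesZalesskii2010, Thm 2.7.1] -/
theorem exists_subset_range_isFreeProSigmaCyclic_of_isClosed_padicPi (hinj : Function.Injective P)
    (H : Subgroup (Multiplicative (∀ i, ℤ_[P i])))
    (hH : IsClosed (H : Set (Multiplicative (∀ i, ℤ_[P i])))) :
    ∃ S' ⊆ Set.range P, AbsTopII.IsFreeProSigmaCyclic S' H := by
  classical
  -- additive copy of `H`
  let H' : AddSubgroup (∀ i, ℤ_[P i]) := Subgroup.toAddSubgroup' H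
  have hmem : ∀ x, x ∈ H' ↔ Multiplicative.ofAdd x ∈ H := fun _ => Iff.rfl
  have hH' : IsClosed (H' : Set (∀ i, ℤ_[P i])) := by
    have h1 : (H' : Set (∀ i, ℤ_[P i])) =
        Multiplicative.ofAdd ⁻¹' (H : Set (Multiplicative (∀ i, ℤ_[P i]))) := rfl
    rw [h1]
    exact hH.preimage continuous_ofAdd
  -- the nonzero slices and their exponents
  have hslice := slice_eq_bot_or_pow_of_isClosed_padicPi P hinj H' hH'
  have hex : ∀ j : {i : ι // ¬ ∀ x ∈ H', x i = 0},
      ∃ e : ℕ, ∀ y : ℤ_[P j.1], Pi.single j.1 y ∈ H' ↔ (P j.1 : ℤ_[P j.1]) ^ e ∣ y :=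
    fun j => (hslice j.1).resolve_left j.2
  choose e he using hex
  -- the parametrisation
  let Φ : (∀ j : {i : ι // ¬ ∀ x ∈ H', x i = 0}, ℤ_[P j.1]) → (∀ i, ℤ_[P i]) := fun y i =>
    if h : ∀ x ∈ H', x i = 0 then 0 else (P i : ℤ_[P i]) ^ e ⟨i, h⟩ * y ⟨i, h⟩
  have hΦcont : Continuous Φ := by
    apply continuous_pi
    intro i
    by_cases h : ∀ x ∈ H', x i = 0
    · have h1 : (fun y => Φ y i) = fun _ => 0 := by funext y; simp only [Φ, dif_pos h]
      rw [h1]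
      exact continuous_const
    · have h1 : (fun y => Φ y i) = fun y => (P i : ℤ_[P i]) ^ e ⟨i, h⟩ * y ⟨i, h⟩ := by
        funext y; simp only [Φ, dif_neg h]
      rw [h1]
      exact continuous_const.mul (continuous_apply _)
  have hΦadd : ∀ y z, Φ (y + z) = Φ y + Φ z := by
    intro y z
    funext i
    by_cases h : ∀ x ∈ H', x i = 0
    · simp only [Φ, dif_pos h, Pi.add_apply, add_zero]
    · simp only [Φ, dif_neg h, Pi.add_apply, mul_add]
  have hΦpos : ∀ (y) (j : {i : ι // ¬ ∀ x ∈ H', x i = 0}),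
      Φ y j.1 = (P j.1 : ℤ_[P j.1]) ^ e j * y j := by
    intro y j
    simp only [Φ, dif_neg j.2]
  have hΦmem : ∀ y, Φ y ∈ H' := by
    intro y
    rw [mem_iff_forall_single_mem_of_isClosed_padicPi P hinj H' hH']
    intro i
    by_cases h : ∀ x ∈ H', x i = 0
    · have h1 : Φ y i = 0 := by simp only [Φ, dif_pos h]
      rw [h1, Pi.single_zero]
      exact H'.zero_mem
    · rw [he ⟨i, h⟩, hΦpos y ⟨i, h⟩]
      exact dvd_mul_right _ _
  have hΦinj : Function.Injective Φ := by
    intro y z hyz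
    funext j
    have h1 := congrFun hyz j.1
    rw [hΦpos, hΦpos] at h1
    exact mul_left_cancel₀ (pow_ne_zero _ (by exact_mod_cast (hP j.1).out.ne_zero)) h1
  have hΦsurj : ∀ x ∈ H', ∃ y, Φ y = x := by
    intro x hx
    have hxi := (mem_iff_forall_single_mem_of_isClosed_padicPi P hinj H' hH' x).mp hx
    have hy : ∀ j : {i : ι // ¬ ∀ x ∈ H', x i = 0},
        ∃ y : ℤ_[P j.1], x j.1 = (P j.1 : ℤ_[P j.1]) ^ e j * y := by
      intro j
      obtain ⟨c, hc⟩ := (he j (x j.1)).mp (hxi j.1)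
      exact ⟨c, hc⟩
    choose y hy using hy
    refine ⟨y, funext fun i => ?_⟩
    by_cases h : ∀ x ∈ H', x i = 0
    · simp only [Φ, dif_pos h]
      exact (h x hx).symm
    · rw [hy ⟨i, h⟩]
      simp only [Φ, dif_neg h]
  -- the continuous multiplicative bijection onto `H`
  let f : Multiplicative (∀ j : {i : ι // ¬ ∀ x ∈ H', x i = 0}, ℤ_[P j.1]) → H := fun y =>
    ⟨Multiplicative.ofAdd (Φ (Multiplicative.toAdd y)), (hmem _).mp (hΦmem _)⟩
  have hfinj : Function.Injective f := by
    intro y z hyz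
    have h1 : Φ (Multiplicative.toAdd y) = Φ (Multiplicative.toAdd z) :=
      Multiplicative.ofAdd.injective (congrArg (fun w : H => (w : Multiplicative (∀ i, ℤ_[P i]))) hyz)
    exact Multiplicative.toAdd.injective (hΦinj h1)
  have hfsurj : Function.Surjective f := by
    intro x
    obtain ⟨y, hy⟩ := hΦsurj (Multiplicative.toAdd (x : Multiplicative (∀ i, ℤ_[P i]))) x.2
    refine ⟨Multiplicative.ofAdd y, Subtype.ext ?_⟩
    change Multiplicative.ofAdd (Φ (Multiplicative.toAdd (Multiplicative.ofAdd y))) = _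
    rw [toAdd_ofAdd, hy, ofAdd_toAdd]
  have hfcont : Continuous f :=
    Continuous.subtype_mk (continuous_ofAdd.comp (hΦcont.comp continuous_toAdd)) _
  haveI : CompactSpace (Multiplicative (∀ j : {i : ι // ¬ ∀ x ∈ H', x i = 0}, ℤ_[P j.1])) :=
    inferInstanceAs (CompactSpace (∀ j : {i : ι // ¬ ∀ x ∈ H', x i = 0}, ℤ_[P j.1]))
  haveI : T2Space (Multiplicative (∀ i, ℤ_[P i])) := inferInstanceAs (T2Space (∀ i, ℤ_[P i]))
  let eₜ : Multiplicative (∀ j : {i : ι // ¬ ∀ x ∈ H', x i = 0}, ℤ_[P j.1]) ≃ₜ H :=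
    Continuous.homeoOfEquivCompactToT2 (f := Equiv.ofBijective f ⟨hfinj, hfsurj⟩) hfcont
  let E : Multiplicative (∀ j : {i : ι // ¬ ∀ x ∈ H', x i = 0}, ℤ_[P j.1]) ≃ₜ* H :=
    { toEquiv := eₜ.toEquiv
      map_mul' := fun y z => by
        change f (y * z) = f y * f z
        refine Subtype.ext ?_
        change Multiplicative.ofAdd (Φ (Multiplicative.toAdd (y * z))) =
          Multiplicative.ofAdd (Φ (Multiplicative.toAdd y)) *
            Multiplicative.ofAdd (Φ (Multiplicative.toAdd z))
        rw [toAdd_mul, hΦadd, ofAdd_add]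
      continuous_toFun := eₜ.continuous
      continuous_invFun := eₜ.symm.continuous }
  -- the model over the sub-family is free pro-`Σ'`-cyclic; transport
  have hι'inj : Function.Injective (fun j : {i : ι // ¬ ∀ x ∈ H', x i = 0} => P j.1) :=
    fun a b hab => Subtype.ext (hinj hab)
  have hmodel := isFreeProSigmaCyclic_padicPi (fun j : {i : ι // ¬ ∀ x ∈ H', x i = 0} => P j.1) hι'inj
  refine ⟨Set.range (fun j : {i : ι // ¬ ∀ x ∈ H', x i = 0} => P j.1), ?_,
    hmodel.of_continuousMulEquiv E⟩
  rintro _ ⟨j, rfl⟩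
  exact ⟨j.1, rfl⟩

end ClosedSubgroupsModel

end Literature.AnabelianGeometry.AbsoluteAnabelian

end
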